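import Summits.QuantumFields.YangMills.Theorems.BalabanUVNodesN19OscillatingLinksMultiscale
import Summits.QuantumFields.YangMills.Theorems.BalabanUVNodesN19CosineSeriesSmooth
import Summits.QuantumFields.YangMills.Theorems.BalabanUVNodesN19SingleModeDegreeBudget

/-!
# YM-DAG node N19 (= NE7 proper) — MULTISCALE TELESCOPING, PART 5b: SMOOTH (C²) LINKS OF THE ℓ¹-NORM AT `≲ V·d·log²t∕t`,
# `V = |h′(0)| + |h′(d)| + d·sup|h″|` — `dist_∞(h(Σ_{i≤d}|x_i|), Π_t) ≤ 50·V·d·log₂t·(log₂t + 19)∕t` for all `t ≥ 18432`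

Cell `pub-ymgap`, HUMAN RULING D-0062 (Track A) ∕ D-0149 (work-bound push), R141 (C) wider-strategy seat `pub-ymgap-dag-n19-e` (strategy
s3 = ALTERNATIVE CURRENCY), generation g30, module 7 (lineage module 124).  Route `Summits/QuantumFields/YangMills/Theses/BalabanUVNodes.lean`,
cluster item K3⁸ «SpineGivenEndpointR13SepCoPHV» (stmt-QuantumFields-27366); filed `--supports` that item `--as helper` (it proves no registered
stub).  COUNT-NEUTRAL: [folklore] over Mathlib and the lineage BY NAME — PART 3 `…N19OscillatingLinksMultiscale`
(`exists_mvPolynomial_near_link_of_trigApprox`), PART 5a `…N19CosineSeriesSmooth` (`abs_sub_cosPartialSum_le`, `abs_integral_mul_cos_le`,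
`sum_inv_succ_sq_shift_le`), PART 2b `…N19SingleModeDegreeBudget` (`exists_dyadicBudget`, `dyadicBudget_bounds`); no laws, no scheme object, no Theses
import; NOT a discharge claim.

CONTENT.  §1 ★★ `exists_mvPolynomial_near_smoothLink_l1Norm`:
for `h ∈ C²` (everywhere derivatives `h′`, `h″`, `h″` continuous, `|h″| ≤ κ` on `[0,d]`; `V = |h′(0)| + |h′(d)| + κd`, `d = |ι| ≥ 1`), every `J` and
`N ≥ 1`, an `MvPolynomial` of total degree `≤ (J+1)(2^{J+2} + 150πN)` within `2dV∕(π²N) + (2dV∕π²)(2(J+1) + 4π(1 + log N))∕2^J` of `h(Σ_i|x_i|)` on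
`[−1,1]^ι` (PART 5a's cosine partial sum — `N` modes at frequencies `π(n+1)∕d`, coefficients `|a_{n+1}| ≤ 2dV∕(π²(n+1)²)`, tail `2dV∕(π²N)` — fed to PART 3).
§2 ★★★ `exists_mvPolynomial_near_smoothLink_l1Norm_degree`: **for all `t ≥ 18432`: `dist_∞(h(Σ_{i≤d}|x_i|), Π_t) ≤ 50·V·d·log₂t·(log₂t + 19)∕t`**
(the dyadic `J ≥ 8` of PART 2b, `N = ⌊2^{J+2}∕(150π)⌋ ≥ 1`).
READING for (v′) (honest): EVERY twice continuously differentiable link of the ℓ¹-norm of `d` strings is at the conjectured ridge rate `d∕t` up to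
`log²t`, with the constant `V = |h′(0)| + |h′(d)| + d·sup|h″|` (`≤ 2 + κd` for a 1-Lipschitz link with curvature `κ`; e.g. `cos(ωs)∕ω`: `V ≤ 2 + ωd` —
consistent with the single-mode law; a bump of width `σ`: `V ≍ d∕σ`).  Nesting (module 111) gave `d∕√t` for all of these.  (v′) PROPER — all 1-Lipschitz
links, `V` unbounded (many small kinks, or curvature `≍ t∕d`) — STAYS OPEN.

HONEST FRAMING (binding).  Elementary and [folklore]; ONE-SIDED (upper bounds); NO consumer in the DAG today (an optimality map of the seat's own
currency, degree model); nothing of Bałaban's instantiated; NE7 NOT PRINTED, NOT proved; N19 NOT discharged; count-neutral.  One finite `T⁴` programme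
at fixed `ε`; nothing continuum ∕ `ℝ⁴` ∕ OS ∕ mass-gap ∕ Clay.  0 `def` ∕ 0 `sorry`.
-/

noncomputable section

open Real Finset

namespace Summit.QuantumFields.YangMills.Theorems.BalabanUVNodesN19SmoothLinksMultiscale

open Summit.QuantumFields.YangMills.Theorems.BalabanUVNodesN19OscillatingLinksMultiscale (exists_mvPolynomial_near_link_of_trigApprox)
open Summit.QuantumFields.YangMills.Theorems.BalabanUVNodesN19CosineSeriesSmooth
  (abs_sub_cosPartialSum_le abs_integral_mul_cos_le sum_inv_succ_sq_shift_le)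
open Summit.QuantumFields.YangMills.Theorems.BalabanUVNodesN19SingleModeDegreeBudget (exists_dyadicBudget dyadicBudget_bounds)

variable {ι : Type*} [Fintype ι]

/-! ## §1 ★★ C² links from the cosine series [folklore] -/

/-- ★★ **C² LINKS OF THE ℓ¹-NORM.**  Let `h` have everywhere derivatives `h′`, `h″` with `h″` continuous and `|h″| ≤ κ` on `[0, d]` (`d = |ι| ≥ 1`),
`V = |h′(0)| + |h′(d)| + κd`.  For every `J` and `N ≥ 1` there is `P : MvPolynomial ι ℝ` of total degree `≤ (J+1)(2^{J+2} + 150πN)` with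
`|h(Σ_i|x_i|) − P(x)| ≤ 2dV∕(π²N) + (2dV∕π²)·(2(J+1) + 4π(1 + log N))∕2^J` on `[−1,1]^ι`: the `N`-term cosine partial sum of `h` on `[0,d]` (PART 5a,
uniform error `2dV∕(π²N)`, coefficients `|a_{n+1}| ≤ 2dV∕(π²(n+1)²)`, frequencies `π(n+1)∕d ≤ πN∕d`) through PART 3's synthesis
(`Σ_{n<N}(n+1)^{−2} ≤ 2`, `Σ_{n<N}(n+1)^{−1} ≤ 1 + log N`). [folklore] -/
theorem exists_mvPolynomial_near_smoothLink_l1Norm [Nonempty ι] {h h' h'' : ℝ → ℝ} (hh : ∀ s, HasDerivAt h (h' s) s)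
    (hh' : ∀ s, HasDerivAt h' (h'' s) s) (hh'' : Continuous h'') {κ : ℝ}
    (hκ : ∀ s ∈ Set.Icc (0 : ℝ) (Fintype.card ι), |h'' s| ≤ κ) (J : ℕ) {N : ℕ} (hN : 1 ≤ N) :
    ∃ P : MvPolynomial ι ℝ, (P.totalDegree : ℝ) ≤ ((J : ℝ) + 1) * (2 ^ (J + 2) + 150 * π * N) ∧
      ∀ x : ι → ℝ, (∀ i, x i ∈ Set.Icc (-1 : ℝ) 1) →
        |h (∑ i, |x i|) - MvPolynomial.eval x P| ≤
          2 * Fintype.card ι * (|h' 0| + |h' (Fintype.card ι)| + κ * Fintype.card ι) / (π ^ 2 * N) +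
            2 * Fintype.card ι * (|h' 0| + |h' (Fintype.card ι)| + κ * Fintype.card ι) / π ^ 2 *
              (2 * ((J : ℝ) + 1) + 4 * π * (1 + Real.log N)) / 2 ^ J := by
  set d : ℝ := (Fintype.card ι : ℝ) with hd
  have hdpos : 0 < d := by rw [hd]; exact_mod_cast (Fintype.card_pos (α := ι))
  have hπ := Real.pi_pos
  set V : ℝ := |h' 0| + |h' d| + κ * d with hV
  have hκ0 : 0 ≤ κ := (abs_nonneg _).trans (hκ 0 ⟨le_rfl, hdpos.le⟩)
  have hV0 : 0 ≤ V := by positivity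
  -- the trigonometric data
  set a : ℕ → ℝ := fun n => 2 / d * ∫ u in (0 : ℝ)..d, h u * Real.cos (π * ((n : ℝ) + 1) / d * u) with ha
  set ω : ℕ → ℝ := fun n => π * ((n : ℝ) + 1) / d with hω
  have hω0 : ∀ n, 0 ≤ ω n := fun n => by positivity
  have hωΩ : ∀ n, n < N → ω n ≤ π * N / d := by
    intro n hn
    simp only [hω]
    rw [div_le_div_iff_of_pos_right hdpos]
    have : (n : ℝ) + 1 ≤ N := by exact_mod_cast hn
    nlinarith
  have hΩ : 0 ≤ π * N / d := by positivity
  have happrox : ∀ s : ℝ, 0 ≤ s → s ≤ Fintype.card ι →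
      |h s - (1 / d * (∫ u in (0 : ℝ)..d, h u) + ∑ n ∈ range N, (a n * Real.cos (ω n * s) + (0 : ℝ) * Real.sin (ω n * s)))| ≤
        2 * d * V / (π ^ 2 * N) := by
    intro s hs0 hsd
    have hb := abs_sub_cosPartialSum_le hh hh' hh'' hdpos hκ hN (s := s) ⟨hs0, hsd⟩
    have e : ∑ n ∈ range N, (a n * Real.cos (ω n * s) + (0 : ℝ) * Real.sin (ω n * s)) =
        ∑ m ∈ range N, (2 / d * ∫ u in (0 : ℝ)..d, h u * Real.cos (π * ((m : ℝ) + 1) / d * u)) *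
          Real.cos (π * ((m : ℝ) + 1) / d * s) := by
      refine Finset.sum_congr rfl fun n _ => ?_
      simp only [ha, hω, zero_mul, add_zero]
    rw [e]
    exact hb
  obtain ⟨P, hdeg, herr⟩ := exists_mvPolynomial_near_link_of_trigApprox (ι := ι) (h := h)
    (1 / d * ∫ u in (0 : ℝ)..d, h u) a (fun _ => 0) ω N hΩ hω0 hωΩ happrox J
  refine ⟨P, hdeg.trans_eq (by rw [← hd]; field_simp), fun x hx => (herr x hx).trans ?_⟩
  rw [← hd]
  refine add_le_add le_rfl ?_
  -- the coefficient sum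
  have h2J : (0 : ℝ) < 2 ^ J := by positivity
  have hcoef : ∀ n, |a n| ≤ 2 * d * V / π ^ 2 * (1 / ((n : ℝ) + 1) ^ 2) := by
    intro n
    have hn1 : 1 ≤ n + 1 := Nat.succ_le_succ (Nat.zero_le n)
    have hb := abs_integral_mul_cos_le hh hh' hh'' hdpos hκ hn1
    have e : (fun u => h u * Real.cos (π * ((n : ℝ) + 1) / d * u)) = fun u => h u * Real.cos (π * ((n + 1 : ℕ) : ℝ) / d * u) := by
      funext u; push_cast; rfl
    simp only [ha]
    rw [abs_mul, abs_of_pos (by positivity : (0 : ℝ) < 2 / d), e]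
    calc 2 / d * |∫ u in (0 : ℝ)..d, h u * Real.cos (π * ((n + 1 : ℕ) : ℝ) / d * u)|
        ≤ 2 / d * ((d / (π * ((n + 1 : ℕ) : ℝ))) ^ 2 * V) := mul_le_mul_of_nonneg_left hb (by positivity)
      _ = 2 * d * V / π ^ 2 * (1 / ((n : ℝ) + 1) ^ 2) := by
          have en : ((n + 1 : ℕ) : ℝ) = (n : ℝ) + 1 := by push_cast; ring
          rw [en]; field_simp
  have hterm : ∀ n ∈ range N, (|a n| + |(0 : ℝ)|) * (((J : ℝ) + 1 + 4 * ω n * Fintype.card ι) / 2 ^ J) ≤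
      2 * d * V / π ^ 2 * (((J : ℝ) + 1) * (1 / ((n : ℝ) + 1) ^ 2) + 4 * π * (1 / ((n : ℝ) + 1))) / 2 ^ J := by
    intro n _
    rw [abs_zero, add_zero, ← hd]
    have hn0 : (0 : ℝ) < (n : ℝ) + 1 := by positivity
    have hfac : 0 ≤ ((J : ℝ) + 1 + 4 * ω n * d) / 2 ^ J := by positivity
    calc |a n| * (((J : ℝ) + 1 + 4 * ω n * d) / 2 ^ J)
        ≤ 2 * d * V / π ^ 2 * (1 / ((n : ℝ) + 1) ^ 2) * (((J : ℝ) + 1 + 4 * ω n * d) / 2 ^ J) :=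
          mul_le_mul_of_nonneg_right (hcoef n) hfac
      _ = 2 * d * V / π ^ 2 * (((J : ℝ) + 1) * (1 / ((n : ℝ) + 1) ^ 2) + 4 * π * (1 / ((n : ℝ) + 1))) / 2 ^ J := by
          simp only [hω]; field_simp
  refine (Finset.sum_le_sum hterm).trans ?_
  rw [← Finset.sum_div, ← Finset.mul_sum, Finset.sum_add_distrib, ← Finset.mul_sum, ← Finset.mul_sum]
  -- `Σ_{n<N}(n+1)^{-2} ≤ 2` and `Σ_{n<N}(n+1)^{-1} ≤ 1 + log N` (both also in the Literature tree:
  -- `QuantumLattice.sum_range_one_div_sq_le_two`, `Edwards2D.sum_range_one_div_succ_le_log`; re-derived here to keep the imports local)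
  have hs1 : ∑ n ∈ range N, 1 / ((n : ℝ) + 1) ^ 2 ≤ 2 := by
    cases N with
    | zero => simp
    | succ N =>
      rw [Finset.sum_range_succ']
      have h := sum_inv_succ_sq_shift_le (le_refl 1) N
      have h0 : (0 : ℝ) ≤ 1 / (((1 : ℕ) : ℝ) + (N : ℝ)) := by positivity
      have ha' : (1 : ℝ) / ((1 : ℕ) : ℝ) = 1 := by norm_num
      have hb' : (1 : ℝ) / (((0 : ℕ) : ℝ) + 1) ^ 2 = 1 := by norm_num
      linarith [h, h0, ha', hb']
  have hs2 : ∑ n ∈ range N, 1 / ((n : ℝ) + 1) ≤ 1 + Real.log N := by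
    have h2 : ((harmonic N : ℚ) : ℝ) = ∑ n ∈ range N, 1 / ((n : ℝ) + 1) := by
      simp only [harmonic, Rat.cast_sum, Rat.cast_inv, Rat.cast_natCast, one_div]
      push_cast
      rfl
    have h3 := harmonic_le_one_add_log N
    rw [h2] at h3
    exact h3
  have hA : 0 ≤ 2 * d * V / π ^ 2 := by positivity
  rw [div_le_div_iff_of_pos_right h2J]
  refine mul_le_mul_of_nonneg_left ?_ hA
  have hJ1 : (0 : ℝ) ≤ (J : ℝ) + 1 := by positivity
  calc ((J : ℝ) + 1) * ∑ n ∈ range N, 1 / ((n : ℝ) + 1) ^ 2 + 4 * π * ∑ n ∈ range N, 1 / ((n : ℝ) + 1)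
      ≤ ((J : ℝ) + 1) * 2 + 4 * π * (1 + Real.log N) :=
        add_le_add (mul_le_mul_of_nonneg_left hs1 hJ1) (mul_le_mul_of_nonneg_left hs2 (by positivity))
    _ = 2 * ((J : ℝ) + 1) + 4 * π * (1 + Real.log N) := by ring

/-! ## §2 ★★★ At a prescribed degree budget [folklore] -/

/-- ★★★ **C² LINKS AT DEGREE `t`: `dist_∞(h(Σ_{i≤d}|x_i|), Π_t) ≤ 50·V·d·log₂t·(log₂t + 19)∕t` for all `t ≥ 18432`**, `V = |h′(0)| + |h′(d)| + κd`
(`h` as in §1).  The dyadic `J` of PART 2b has `J ≥ 8`, so `N = ⌊2^{J+2}∕(150π)⌋ ≥ 1`, `150πN ≤ 2^{J+2}` keeps the degree `≤ (J+1)2^{J+3} ≤ t`,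
`1∕N ≤ 300π∕2^{J+2}`, `log N ≤ J + 2`, `1∕2^J ≤ 16(J+2)∕t` and `J + 3 ≤ log₂t`.  EVERY twice continuously differentiable link of the ℓ¹-norm of `d` strings
is at the conjectured ridge rate up to `log²`. [folklore] -/
theorem exists_mvPolynomial_near_smoothLink_l1Norm_degree [Nonempty ι] {h h' h'' : ℝ → ℝ} (hh : ∀ s, HasDerivAt h (h' s) s)
    (hh' : ∀ s, HasDerivAt h' (h'' s) s) (hh'' : Continuous h'') {κ : ℝ}
    (hκ : ∀ s ∈ Set.Icc (0 : ℝ) (Fintype.card ι), |h'' s| ≤ κ) {t : ℕ} (ht : 18432 ≤ t) :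
    ∃ P : MvPolynomial ι ℝ, P.totalDegree ≤ t ∧
      ∀ x : ι → ℝ, (∀ i, x i ∈ Set.Icc (-1 : ℝ) 1) →
        |h (∑ i, |x i|) - MvPolynomial.eval x P| ≤
          50 * (|h' 0| + |h' (Fintype.card ι)| + κ * Fintype.card ι) * Fintype.card ι * Real.logb 2 t * (Real.logb 2 t + 19) / t := by
  set d : ℝ := (Fintype.card ι : ℝ) with hd
  have hdpos : 0 < d := by rw [hd]; exact_mod_cast (Fintype.card_pos (α := ι))
  have hπ := Real.pi_pos
  have hπ3 : π ≤ 3.15 := Real.pi_lt_d2.le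
  set V : ℝ := |h' 0| + |h' d| + κ * d with hV
  have hκ0 : 0 ≤ κ := (abs_nonneg _).trans (hκ 0 ⟨le_rfl, hdpos.le⟩)
  have hV0 : 0 ≤ V := by positivity
  obtain ⟨J, h1, h2⟩ := exists_dyadicBudget (le_trans (by norm_num) ht)
  obtain ⟨hinv, hlog, htle, hlog3⟩ := dyadicBudget_bounds h1 h2
  set L : ℝ := Real.logb 2 t with hL
  have ht0 : (0 : ℝ) < t := by exact_mod_cast lt_of_lt_of_le (by norm_num) ht
  have hJ0 : (0 : ℝ) ≤ J := Nat.cast_nonneg _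
  have hJ8 : 8 ≤ J := by
    by_contra hJ
    have hJ7 : J ≤ 7 := by omega
    have : (J + 2) * 2 ^ (J + 4) ≤ 9 * 2 ^ 11 :=
      Nat.mul_le_mul (by omega) (Nat.pow_le_pow_right two_pos (by omega))
    omega
  have h2J2 : (1024 : ℝ) ≤ 2 ^ (J + 2) := by
    have : (2 : ℝ) ^ 10 ≤ 2 ^ (J + 2) := pow_le_pow_right₀ one_le_two (by omega)
    norm_num at this; exact this
  -- the number of modes
  obtain ⟨N, hN⟩ : ∃ N : ℕ, N = ⌊(2 : ℝ) ^ (J + 2) / (150 * π)⌋₊ := ⟨_, rfl⟩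
  have hNle : (N : ℝ) ≤ 2 ^ (J + 2) / (150 * π) := by rw [hN]; exact Nat.floor_le (by positivity)
  have hNlt : (2 : ℝ) ^ (J + 2) / (150 * π) < N + 1 := by rw [hN]; exact Nat.lt_floor_add_one _
  have hN1 : 1 ≤ N := by
    have h1le : (1 : ℝ) ≤ 2 ^ (J + 2) / (150 * π) := by
      rw [le_div_iff₀ (by positivity)]; nlinarith
    rw [hN]; exact Nat.le_floor (by rw [Nat.cast_one]; exact h1le)
  have hN1r : (1 : ℝ) ≤ N := by exact_mod_cast hN1
  clear hN
  obtain ⟨P, hdeg, herr⟩ := exists_mvPolynomial_near_smoothLink_l1Norm (ι := ι) hh hh' hh'' hκ J hN1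
  refine ⟨P, ?_, fun x hx => (herr x hx).trans ?_⟩
  · -- degree
    have hb : ((J : ℝ) + 1) * (2 ^ (J + 2) + 150 * π * N) ≤ ((J + 1) * 2 ^ (J + 3) : ℕ) := by
      push_cast
      have h3 : 150 * π * (N : ℝ) ≤ 2 ^ (J + 2) := by
        have := mul_le_mul_of_nonneg_left hNle (by positivity : (0 : ℝ) ≤ 150 * π)
        rwa [mul_div_cancel₀ _ (by positivity : (150 : ℝ) * π ≠ 0)] at this
      calc ((J : ℝ) + 1) * (2 ^ (J + 2) + 150 * π * N) ≤ ((J : ℝ) + 1) * (2 ^ (J + 2) + 2 ^ (J + 2)) :=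
            mul_le_mul_of_nonneg_left (add_le_add le_rfl h3) (by positivity)
        _ = ((J : ℝ) + 1) * 2 ^ (J + 3) := by ring
    exact (Nat.cast_le.1 (hdeg.trans hb)).trans h1
  · -- error
    rw [← hd]
    have h2Jp : (0 : ℝ) < 2 ^ J := by positivity
    have hdV : 0 ≤ d * V := mul_nonneg hdpos.le hV0
    have hL0 : 0 ≤ L := le_trans (by norm_num) hlog3
    -- `1/N ≤ 75π/2^J`
    have hN2 : (2 : ℝ) ^ (J + 2) ≤ 300 * π * N := by
      have : (2 : ℝ) ^ (J + 2) < 150 * π * (N + 1) := by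
        rw [div_lt_iff₀ (by positivity)] at hNlt; linarith only [hNlt]
      nlinarith only [this, hN1r, hπ]
    have hNinv : 1 / (N : ℝ) ≤ 75 * π / 2 ^ J := by
      rw [div_le_div_iff₀ (by positivity) h2Jp]
      have e : (2 : ℝ) ^ (J + 2) = 4 * 2 ^ J := by ring
      linarith only [hN2, e]
    have hinvN : 2 * d * V / (π ^ 2 * N) ≤ 48 * (d * V) * (1 / 2 ^ J) := by
      have h150 : 150 / π ≤ (48 : ℝ) := by
        rw [div_le_iff₀ hπ]; linarith only [Real.pi_gt_d2]
      calc 2 * d * V / (π ^ 2 * N) = 2 * (d * V) / π ^ 2 * (1 / N) := by field_simp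
        _ ≤ 2 * (d * V) / π ^ 2 * (75 * π / 2 ^ J) := mul_le_mul_of_nonneg_left hNinv (by positivity)
        _ = 150 / π * (d * V) * (1 / 2 ^ J) := by field_simp; ring
        _ ≤ 48 * (d * V) * (1 / 2 ^ J) := by
            have := mul_le_mul_of_nonneg_right h150 (mul_nonneg hdV (by positivity : (0 : ℝ) ≤ 1 / 2 ^ J))
            linarith only [this]
    -- `log N ≤ J + 2`
    have hlogN : Real.log N ≤ (J : ℝ) + 2 := by
      have hNpos : (0 : ℝ) < N := by linarith only [hN1r]
      have h150 : (1 : ℝ) ≤ 150 * π := by linarith only [Real.pi_gt_three]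
      have hN2' : (N : ℝ) ≤ 2 ^ (J + 2) := hNle.trans (div_le_self (by positivity) h150)
      have hl2 : Real.log 2 ≤ 1 := by have := Real.log_two_lt_d9; linarith only [this]
      calc Real.log N ≤ Real.log (2 ^ (J + 2)) := Real.log_le_log hNpos hN2'
        _ = ((J + 2 : ℕ) : ℝ) * Real.log 2 := by rw [Real.log_pow]
        _ ≤ ((J + 2 : ℕ) : ℝ) * 1 := mul_le_mul_of_nonneg_left hl2 (Nat.cast_nonneg _)
        _ = (J : ℝ) + 2 := by push_cast; ring
    have hB : 2 * d * V / π ^ 2 * (2 * ((J : ℝ) + 1) + 4 * π * (1 + Real.log N)) / 2 ^ J ≤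
        (d * V) * (3 * J + 9) * (1 / 2 ^ J) := by
      rw [div_eq_mul_one_div _ ((2 : ℝ) ^ J)]
      refine mul_le_mul_of_nonneg_right ?_ (by positivity)
      have hlog1 : 1 + Real.log N ≤ (J : ℝ) + 3 := by linarith only [hlogN]
      have hx : 2 * ((J : ℝ) + 1) + 4 * π * (1 + Real.log N) ≤ 2 * ((J : ℝ) + 1) + 4 * π * ((J : ℝ) + 3) := by
        have := mul_le_mul_of_nonneg_left hlog1 (by positivity : (0 : ℝ) ≤ 4 * π)
        linarith only [this]
      have hπ2 : (9.8596 : ℝ) ≤ π ^ 2 := by nlinarith only [Real.pi_gt_d2, hπ]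
      have hfrac : (4 * ((J : ℝ) + 1) + 8 * π * ((J : ℝ) + 3)) / π ^ 2 ≤ 3 * J + 9 := by
        rw [div_le_iff₀ (by positivity)]
        have ha := mul_le_mul_of_nonneg_left hπ2 (by positivity : (0 : ℝ) ≤ 3 * J + 9)
        have hb := mul_le_mul_of_nonneg_right hπ3 (by positivity : (0 : ℝ) ≤ 8 * ((J : ℝ) + 3))
        linarith only [ha, hb, hJ0]
      calc 2 * d * V / π ^ 2 * (2 * ((J : ℝ) + 1) + 4 * π * (1 + Real.log N))
          ≤ 2 * d * V / π ^ 2 * (2 * ((J : ℝ) + 1) + 4 * π * ((J : ℝ) + 3)) :=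
            mul_le_mul_of_nonneg_left hx (div_nonneg (by linarith only [hdV]) (by positivity))
        _ = (d * V) * ((4 * ((J : ℝ) + 1) + 8 * π * ((J : ℝ) + 3)) / π ^ 2) := by field_simp; ring
        _ ≤ (d * V) * (3 * J + 9) := mul_le_mul_of_nonneg_left hfrac hdV
    have hJL : (J : ℝ) + 2 ≤ L := by linarith only [hlog]
    have h3 : (3 : ℝ) * J + 57 ≤ 3 * (L + 19) := by linarith only [hlog]
    calc 2 * d * V / (π ^ 2 * N) + 2 * d * V / π ^ 2 * (2 * ((J : ℝ) + 1) + 4 * π * (1 + Real.log N)) / 2 ^ J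
        ≤ 48 * (d * V) * (1 / 2 ^ J) + (d * V) * (3 * J + 9) * (1 / 2 ^ J) := add_le_add hinvN hB
      _ = (d * V) * (3 * J + 57) * (1 / 2 ^ J) := by ring
      _ ≤ (d * V) * (3 * J + 57) * (16 * ((J : ℝ) + 2) / t) :=
          mul_le_mul_of_nonneg_left hinv (mul_nonneg hdV (by positivity))
      _ = 16 * (d * V) * (((J : ℝ) + 2) * (3 * J + 57)) / t := by ring
      _ ≤ 16 * (d * V) * (L * (3 * (L + 19))) / t := by
          refine div_le_div_of_nonneg_right ?_ ht0.le
          refine mul_le_mul_of_nonneg_left ?_ (mul_nonneg (by norm_num) hdV)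
          exact mul_le_mul hJL h3 (by positivity) hL0
      _ = 48 * V * d * L * (L + 19) / t := by ring
      _ ≤ 50 * V * d * L * (L + 19) / t := by
          refine div_le_div_of_nonneg_right ?_ ht0.le
          have hP : 0 ≤ V * d * L * (L + 19) :=
            mul_nonneg (mul_nonneg (mul_nonneg hV0 hdpos.le) hL0) (by linarith only [hL0])
          linarith only [hP]

end Summit.QuantumFields.YangMills.Theorems.BalabanUVNodesN19SmoothLinksMultiscale

end
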